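import Literature.NumberTheory.EllipticCurves.SkinnerUrban2014.GL2MainConjecture
import Literature.NumberTheory.EllipticCurves.Rank1Residual.Predicates
import HarnessLib

/-!
# U3 / ROUTE-BK definition request D1 (minimal typing): the COMPANION relation `g ≡ f_E (mod λ)` at `3`
# for a weight-2 newform `g` of level prime to `3` (cell `bsd-uniform`, track U3, seat u3-p2; draft)

HONEST FRAMING: ONE predicate and its unfolding lemma; nothing asserted, no instance of the route's
interface is built here. `HOME/u3/ROUTE-BK.md` §2 D1 asks for "`IsCompanion W g` / the set `S₂(E[3])`:
weight-2 newforms `g` of level prime to `3`, 3-ordinary, with `ρ̄_{g,𝔭} ≅ E[3]`". The tree has no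
residual representation ATTACHED TO A NEWFORM as a theorem (S–U's `residualRep Δ` is the reduction of an
integral DATUM `Δ : OrdinaryNewformDatum g p ι`, a hypothesis structure); the minimal print-faithful
typing of the congruence is therefore by HECKE EIGENVALUES: for the embedding `ι : coeffField g → ℚ̄₃`
(which singles out the prime `λ ∣ 3`), `ι(a_ℓ(g)) ≡ a_ℓ(E) (mod λ)`, i.e. `‖ι(a_ℓ(g)) − a_ℓ(E)‖ < 1`,
at every prime `ℓ ∤ 3M` of good reduction for `E` — for an absolutely irreducible `E[3]` this is
EQUIVALENT to `ρ̄_{g,λ} ≅ E[3] ⊗ k_λ` by Brauer–Nesbitt and Chebotarev (Kim–Lee–Ponsinet §2.1: "S_k(ρ̄)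
the set of newforms … such that the residual representation is isomorphic to ρ̄", arXiv:1909.01764
p0006 L5–6; Diamond–Taylor / DDT §3: congruence of eigenvalues outside the level ⟺ isomorphic
semisimplified residual representations). 3-ORDINARITY of `g` (`λ ∤ a₃(g)`, i.e. `‖ι(a₃(g))‖ = 1`) is
the S–U binder shape (`SkinnerUrban2014.thm1_…`: `‖ι ⟨(qExpansion 1 ⇑g).coeff p, _⟩‖ = 1`).
References: [Kim2019KatoInvariants] §2.1; [SkinnerUrban2014] Thm. 1 (p. 2) binders; [Edixhoven1992]
Thm. 4.5, [Gross1990], [ColemanVoloch1992] (companion forms: existence on the split locus — NOT asserted here).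
-/

noncomputable section

open scoped Classical MatrixGroups ModularForm

open CongruenceSubgroup UpperHalfPlane WeierstrassCurve Literature.NumberTheory.EllipticCurves.ModularForms

namespace Summit.BirchSwinnertonDyer.Uniform.U3.RouteBK

/-- **D1 (minimal typing): `(g, ι)` is a COMPANION AVATAR of `W` at `3`.** `g` is a weight-2 newform of
level `M` with trivial character (`IsNewform0 g`), `3 ∤ M`, `g` is 3-ORDINARY for the prime `λ ∣ 3` cut
out by `ι : coeffField g →+* ℚ̄₃` (`‖ι(a₃(g))‖ = 1`), and `g ≡ f_W (mod λ)`: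
`‖ι(a_ℓ(g)) − a_ℓ(W)‖ < 1` for every prime `ℓ ≠ 3`, `ℓ ∤ M`, of good reduction for `W` — for `W[3]`
absolutely irreducible equivalent to `ρ̄_{g,λ} ≅ W[3] ⊗ k_λ` (Brauer–Nesbitt + Chebotarev). A
predicate; nothing asserted (existence on the split locus is ROUTE-BK's K2, a separate statement).
[cite: Kim2019KatoInvariants, §2.1 (arXiv:1909.01764 p0006 L5–6: the congruence class S_k(ρ̄))]
[cite: SkinnerUrban2014, Thm. 1 (p. 2) (the binder shapes: newform, p ∤ M, a_p a λ-adic unit)] -/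
def IsCompanionOf (W : WeierstrassCurve ℚ) [W.IsGloballyMinimal] {M : ℕ} [NeZero M]
    (g : CuspForm (Gamma0 M) 2) (ι : coeffField g →+* PadicAlgCl 3) : Prop :=
  IsNewform0 g ∧ ¬ 3 ∣ M ∧
    ‖ι ⟨(qExpansion 1 ⇑g).coeff 3, coeff_mem_coeffField g 3⟩‖ = 1 ∧
    ∀ (ℓ : ℕ) [Fact ℓ.Prime], ℓ ≠ 3 → ¬ ℓ ∣ M → W.HasGoodReductionAtPrime ℓ →
      ‖ι ⟨(qExpansion 1 ⇑g).coeff ℓ, coeff_mem_coeffField g ℓ⟩ - (W.frobeniusTrace ℓ : PadicAlgCl 3)‖ < 1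

/-- Unfolding `IsCompanionOf`. [cite: Kim2019KatoInvariants, §2.1 (p0006 L5–6)] -/
theorem isCompanionOf_iff (W : WeierstrassCurve ℚ) [W.IsGloballyMinimal] {M : ℕ} [NeZero M]
    (g : CuspForm (Gamma0 M) 2) (ι : coeffField g →+* PadicAlgCl 3) :
    IsCompanionOf W g ι ↔
      IsNewform0 g ∧ ¬ 3 ∣ M ∧
        ‖ι ⟨(qExpansion 1 ⇑g).coeff 3, coeff_mem_coeffField g 3⟩‖ = 1 ∧
        ∀ (ℓ : ℕ) [Fact ℓ.Prime], ℓ ≠ 3 → ¬ ℓ ∣ M → W.HasGoodReductionAtPrime ℓ →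
          ‖ι ⟨(qExpansion 1 ⇑g).coeff ℓ, coeff_mem_coeffField g ℓ⟩ -
              (W.frobeniusTrace ℓ : PadicAlgCl 3)‖ < 1 :=
  Iff.rfl

/-- A companion has level prime to `3` and is 3-ordinary (projections, for the kit's `SUHyp`-side
consumers). [cite: SkinnerUrban2014, Thm. 1 (p. 2)] -/
theorem IsCompanionOf.not_dvd_level {W : WeierstrassCurve ℚ} [W.IsGloballyMinimal] {M : ℕ} [NeZero M]
    {g : CuspForm (Gamma0 M) 2} {ι : coeffField g →+* PadicAlgCl 3} (h : IsCompanionOf W g ι) :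
    ¬ 3 ∣ M ∧ ‖ι ⟨(qExpansion 1 ⇑g).coeff 3, coeff_mem_coeffField g 3⟩‖ = 1 :=
  ⟨h.2.1, h.2.2.1⟩

end Summit.BirchSwinnertonDyer.Uniform.U3.RouteBK

end
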